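import Summits.ABC.FunctionField.TransferSheet
import Literature.Barriers.ABC.EpsilonCannotBeDroppedPolylog
import Literature.Barriers.ABC.SzpiroEpsilonCannotBeDroppedHolds
import Literature.NumberTheory.DiophantineGeometry.GenEllThm21With
import HarnessLib
import HarnessLib.Audit

/-!
# Cell abc-ff — transfer sheet: WINDOW GUARDS, part 1 (the junk-parameter ranges of the sheet's
# parametric requirement shapes `PolySzpiroWith` / `RKSPolar` / `PolyAbcWith` / `ABCWithExponent`,
# refuted AS TYPED in the kernel)

`Summits/ABC/FunctionField/TransferSheetWindow.lean` (cell abc-ff; kernel certificates by the cell's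
referee B, abc-ff-ref-2, `HOME/ref-2/RefB_v02_tree.lean`, farm rc 0, re-pointed to the tree decls and
landed by the typer). Every parametric `@[conjecture]` shape of `TransferSheet.lean` /
`TransferSheetMason.lean` has a junk range where it is simply FALSE; these theorems pin it, so that no
census row may posit the shape there:
* `not_polySzpiroWith_of_le_six` — POLY-SZPIRO(K) is false for `K ≤ 6` (Masser 1990, tree
  `Literature.Barriers.ABC.not_szpiro_epsilon_zero_holds`); hence `not_rksPolar_of_nonpos`: `R_KSλ` is
  false for `λ ≤ 0` (row CF-2: conjectural only for `λ > 0`).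
* `not_polyAbcWith_of_le_one` — POLY-abc(M) is false for `M ≤ 1`, and `not_abcWithExponent_of_lt_one`
  — `GenEll.ABCWithExponent Λ` is false for `Λ < 1` (Stewart–Tijdeman / Bombieri–Gubler 12.4.12 hits,
  tree `Literature.Barriers.ABC.exists_abc_triple_polylog_loss`); so the CF-6 consequence currency is
  conjectural only for `Λ ≥ 1`.
* (sibling `TransferSheetWindowHits.lean`, which needs the Mason module: the hits-only Mason requirement
  is false for `η ≤ 0` and its Mason-exact polylog form is false for every `A`.)

HONESTY: abc is not proved by any of this; these are negative results about junk parameters.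
-/

noncomputable section

open Literature.NumberTheory.DiophantineGeometry
open Literature.Barriers.ABC Literature.Barriers.ABC.Pasten

namespace Summit.ABC.FunctionField

/-! ### POLY-SZPIRO(K): refuted for `K ≤ 6`; `R_KSλ` refuted for `λ ≤ 0` -/

/-- **POLY-SZPIRO(K) is refuted as typed for every `K ≤ 6`** (Masser 1990 via the tree's
`not_szpiro_epsilon_zero_holds`; `N ≥ 1` makes `K ↦ N^K` monotone). [cite: Masser1990, Theorem] -/
theorem not_polySzpiroWith_of_le_six {K : ℝ} (hK : K ≤ 6) :
    ¬ PolySzpiroWith K := by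
  rintro ⟨C, hC⟩
  apply not_szpiro_epsilon_zero_holds
  refine ⟨Real.exp C, fun W _ => ?_⟩
  have hNpos : 0 < (W.conductorNorm ℤ : ℝ) := by exact_mod_cast W.conductorNorm_pos_holds
  have hN1 : 1 ≤ (W.conductorNorm ℤ : ℝ) := by exact_mod_cast W.conductorNorm_pos_holds
  have h1 := hC W
  by_cases hD : W.minimalDiscriminantNorm ℤ = 0
  · rw [hD, Nat.cast_zero]
    exact mul_nonneg (Real.exp_pos _).le (pow_nonneg hNpos.le 6)
  have hDpos : 0 < (W.minimalDiscriminantNorm ℤ : ℝ) := by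
    exact_mod_cast Nat.pos_of_ne_zero hD
  have h2 : K * Real.log (W.conductorNorm ℤ : ℝ) ≤ 6 * Real.log (W.conductorNorm ℤ : ℝ) :=
    mul_le_mul_of_nonneg_right hK (Real.log_nonneg hN1)
  have h12 : Real.log (W.minimalDiscriminantNorm ℤ : ℝ) ≤ 6 * Real.log (W.conductorNorm ℤ : ℝ) + C := by
    linarith
  have h3 := Real.exp_le_exp.mpr h12
  rw [Real.exp_log hDpos, Real.exp_add, mul_comm] at h3
  calc (W.minimalDiscriminantNorm ℤ : ℝ)
      ≤ Real.exp C * Real.exp (6 * Real.log (W.conductorNorm ℤ : ℝ)) := h3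
    _ = Real.exp C * (W.conductorNorm ℤ : ℝ) ^ (6 : ℕ) := by
        rw [← Real.rpow_natCast, Real.rpow_def_of_pos hNpos, mul_comm (Real.log _)]
        norm_num

/-- In particular the tree decl at `K = 6` is FALSE (Masser): POLY-SZPIRO(6) is not a requirement
anyone may posit. [cite: Masser1990, Theorem] -/
theorem not_polySzpiroWith_six : ¬ PolySzpiroWith 6 :=
  not_polySzpiroWith_of_le_six le_rfl


/-- **Row CF-2 window guard: `R_KSλ` is refuted as typed for every `λ ≤ 0`** (it would give
POLY-SZPIRO(6 + λ) with `6 + λ ≤ 6`, `polySzpiroWith_of_rksPolar`). The requirement is conjectural only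
for `λ > 0`. [folklore] -/
theorem not_rksPolar_of_nonpos {lam : ℝ} (hlam : lam ≤ 0) : ¬ RKSPolar lam := fun h =>
  not_polySzpiroWith_of_le_six (by linarith) (polySzpiroWith_of_rksPolar h)

/-! ### POLY-abc(M): refuted for `M ≤ 1`; `GenEll.ABCWithExponent Λ` refuted for `Λ < 1` -/

/-- **POLY-abc(M) is refuted as typed for every `M ≤ 1`**: Stewart–Tijdeman / Bombieri–Gubler
12.4.12 hits (`exists_abc_triple_polylog_loss`, exponent-`0` polylog) have `c > C'·rad(abc)`
for every `C'`. [cite: BombieriGubler2006, Prop. 12.4.12] -/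
theorem not_polyAbcWith_of_le_one {M : ℝ} (hM : M ≤ 1) :
    ¬ PolyAbcWith M := by
  rintro ⟨C, hC⟩
  obtain ⟨a, b, c, habc, -, -, hlt⟩ := exists_abc_triple_polylog_loss 0 (max C 1) 0
  have h1 := hC a b c habc
  have hR1 : (1 : ℝ) ≤ ((rad a b c : ℕ) : ℝ) := by exact_mod_cast Nat.radical_pos (a * b * c)
  have h2 : ((rad a b c : ℕ) : ℝ) ^ M ≤ ((rad a b c : ℕ) : ℝ) := by
    conv_rhs => rw [← Real.rpow_one ((rad a b c : ℕ) : ℝ)]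
    exact Real.rpow_le_rpow_of_exponent_le hR1 hM
  have h3 : (c : ℝ) ≤ max C 1 * ((rad a b c : ℕ) : ℝ) :=
    calc (c : ℝ) ≤ C * ((rad a b c : ℕ) : ℝ) ^ M := h1
      _ ≤ max C 1 * ((rad a b c : ℕ) : ℝ) ^ M :=
          mul_le_mul_of_nonneg_right (le_max_left _ _) (Real.rpow_nonneg (by linarith) _)
      _ ≤ max C 1 * ((rad a b c : ℕ) : ℝ) :=
          mul_le_mul_of_nonneg_left h2 (by positivity)
  simp only [pow_zero, mul_one] at hlt
  linarith

/-- In particular the tree decl at `M = 1` is FALSE (Stewart–Tijdeman): POLY-abc(1) with a constant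
is not a requirement anyone may posit. [cite: BombieriGubler2006, Prop. 12.4.12] -/
theorem not_polyAbcWith_one : ¬ PolyAbcWith 1 :=
  not_polyAbcWith_of_le_one le_rfl

/-- **`GenEll.ABCWithExponent Λ` is refuted for every `Λ < 1`** (choose `ε` with `Λ(1+ε) ≤ 1`);
hence lens-2's `ParshinHeightConsequence Λ`, `Λ < 1`, is refuted through its own skeleton. The
CF-6 consequence currency is conjectural only for `Λ ≥ 1`. [cite: BombieriGubler2006, Prop. 12.4.12] -/
theorem not_abcWithExponent_of_lt_one {Λ : ℝ} (hΛ : Λ < 1) : ¬ GenEll.ABCWithExponent Λ := by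
  intro h
  rcases le_or_gt Λ 0 with hΛ0 | hΛ0
  · -- ε = 1: exponent 2Λ ≤ 0
    obtain ⟨C, -, hC⟩ := h 1 one_pos
    obtain ⟨a, b, c, habc, -, -, hlt⟩ := exists_abc_triple_polylog_loss 0 (max C 1) 0
    have hR1 : (1 : ℝ) ≤ ((rad a b c : ℕ) : ℝ) := by exact_mod_cast Nat.radical_pos (a * b * c)
    have h2 : ((rad a b c : ℕ) : ℝ) ^ (Λ * (1 + 1)) ≤ ((rad a b c : ℕ) : ℝ) := by
      calc ((rad a b c : ℕ) : ℝ) ^ (Λ * (1 + 1)) ≤ ((rad a b c : ℕ) : ℝ) ^ (1 : ℝ) :=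
            Real.rpow_le_rpow_of_exponent_le hR1 (by linarith)
        _ = _ := Real.rpow_one _
    have h1 := hC a b c habc
    simp only [pow_zero, mul_one] at hlt
    have : (c : ℝ) < max C 1 * ((rad a b c : ℕ) : ℝ) :=
      calc (c : ℝ) < C * ((rad a b c : ℕ) : ℝ) ^ (Λ * (1 + 1)) := h1
        _ ≤ max C 1 * ((rad a b c : ℕ) : ℝ) ^ (Λ * (1 + 1)) :=
            mul_le_mul_of_nonneg_right (le_max_left _ _) (Real.rpow_nonneg (by linarith) _)
        _ ≤ max C 1 * ((rad a b c : ℕ) : ℝ) := mul_le_mul_of_nonneg_left h2 (by positivity)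
    linarith
  · -- ε = (1 - Λ)/Λ > 0 gives exponent Λ(1+ε) = 1
    obtain ⟨C, -, hC⟩ := h ((1 - Λ) / Λ) (div_pos (by linarith) hΛ0)
    obtain ⟨a, b, c, habc, -, -, hlt⟩ := exists_abc_triple_polylog_loss 0 (max C 1) 0
    have hexp : Λ * (1 + (1 - Λ) / Λ) = 1 := by field_simp; ring
    have h1 := hC a b c habc
    rw [hexp, Real.rpow_one] at h1
    simp only [pow_zero, mul_one] at hlt
    have : (c : ℝ) < max C 1 * ((rad a b c : ℕ) : ℝ) :=
      h1.trans_le (mul_le_mul_of_nonneg_right (le_max_left _ _) (by positivity))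
    linarith

end Summit.ABC.FunctionField

end
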